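import Mathlib
import Summits.Ventures.PercRepro2.A3Fibre
import Summits.Ventures.PercRepro2.Exploration
import Summits.Ventures.PercRepro2.Harris

/-!
# The T / T′ fibres of the a₃-exploration: the fibre slack is a Harris covariance
(blind cell PercRepro2, p5 g12; `proofs/P5-A3FIBRE.md` §2, S4 §2.4 (n))

On a fibre `Q ∩ {C(a₃) = W}` with `a₁ ∈ W ∌ a₂` (world T′) the event `Q` is automatic
(`fibre_eq_of_mem_left`), `C(a₁) = W`, and by the spatial Markov property (`Exploration.lean`)
the connections of `a₂` are those of the graph with the edges touching `W` removed
(`prob_fibre_conn_right`).  The fibre slack of `A3Fibre.slack` is then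
`2·P(C(a₃) = W)²·[P(b ∈ C₂, o ∈ C₂ in G − W) − P(b ∈ C₂ in G − W)·P(o ∈ C₂ in G − W)] ≥ 0` when
`b, o ∉ W` (Harris: the two deleted-graph connection events are up-sets) and `0` otherwise:
**`slack_nonneg_of_mem_left`**; the world T (`a₂ ∈ W ∌ a₁`) is the mirror
`slack_nonneg_of_mem_right`.  The A-fibres (neither root in `W`, BHK06 Thm 1.4 on `G − W`) and
the assembly `Gc = P(PD)·P(Q)·(∑ W, slack W / mW W + btw)` are the remaining Lean items of the
reduction `A3Between → HCov`.
-/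

namespace Summit.Ventures.PercRepro2

open UnionCluster

namespace CovForm

namespace A3Fibre

section Left

variable {V : Type*} {E : Type*} [Fintype V] [DecidableEq V] [Fintype E] [DecidableEq E]

omit [Fintype V] [DecidableEq V] [Fintype E] [DecidableEq E] in
/-- On a fibre with `a₁ ∈ W ∌ a₂` the event `Q = {a₁ ↮ a₂}` is automatic. -/
lemma fibre_eq_of_mem_left (ends : E → Sym2 V) (a₁ a₂ a₃ : V) {W : Finset V} (h₁ : a₁ ∈ W)
    (h₂ : a₂ ∉ W) : fibre ends a₁ a₂ a₃ W = clusterEvent ends a₃ (↑W : Set V) := by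
  ext ω
  simp only [fibre, Set.mem_inter_iff, mem_clusterEvent]
  constructor
  · exact fun h => h.2
  · intro h
    refine ⟨?_, h⟩
    rw [mem_avoidAll]
    simp only [Finset.mem_singleton, forall_eq]
    intro hc
    apply h₂
    have ha₁ : Conn ends ω a₃ a₁ := by
      have : a₁ ∈ cluster ends ω a₃ := by rw [h]; exact Finset.mem_coe.2 h₁
      exact this
    have : a₂ ∈ cluster ends ω a₃ := conn_trans ha₁ (conn_symm hc)
    rw [h] at this
    exact Finset.mem_coe.1 this

omit [Fintype V] [DecidableEq V] [Fintype E] [DecidableEq E] in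
/-- On `{C(a₃) = W}` with `a₁ ∈ W`, `a₁ ↔ v` iff `v ∈ W`. -/
lemma conn_left_iff_of_mem_cluster {ends : E → Sym2 V} {a₁ a₃ v : V} {W : Finset V}
    (h₁ : a₁ ∈ W) {ω : Config E} (hω : ω ∈ clusterEvent ends a₃ (↑W : Set V)) :
    Conn ends ω a₁ v ↔ v ∈ W := by
  rw [mem_clusterEvent] at hω
  have ha₁ : Conn ends ω a₃ a₁ := by
    have : a₁ ∈ cluster ends ω a₃ := by rw [hω]; exact Finset.mem_coe.2 h₁
    exact this
  constructor
  · intro h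
    have : v ∈ cluster ends ω a₃ := conn_trans ha₁ h
    rw [hω] at this
    exact Finset.mem_coe.1 this
  · intro hv
    have : Conn ends ω a₃ v := by
      have : v ∈ cluster ends ω a₃ := by rw [hω]; exact Finset.mem_coe.2 hv
      exact this
    exact conn_trans (conn_symm ha₁) this

omit [Fintype V] [DecidableEq V] [Fintype E] [DecidableEq E] in
/-- On `{C(a₃) = W}` with `a₂ ∉ W`, `a₂ ↔ v` is impossible for `v ∈ W`. -/
lemma not_conn_right_of_mem_cluster {ends : E → Sym2 V} {a₂ a₃ v : V} {W : Finset V}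
    (h₂ : a₂ ∉ W) (hv : v ∈ W) {ω : Config E} (hω : ω ∈ clusterEvent ends a₃ (↑W : Set V)) :
    ¬ Conn ends ω a₂ v := by
  intro h
  rw [mem_clusterEvent] at hω
  have hv' : Conn ends ω a₃ v := by
    have : v ∈ cluster ends ω a₃ := by rw [hω]; exact Finset.mem_coe.2 hv
    exact this
  have : a₂ ∈ cluster ends ω a₃ := conn_trans hv' (conn_symm h)
  rw [hω] at this
  exact h₂ (Finset.mem_coe.1 this)

open Classical in
/-- The deleted-graph connection event `{a₂ ↔ v in G − W}`. -/
noncomputable def Rv (ends : E → Sym2 V) (a₂ v : V) (W : Finset V) : Set (Config E) :=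
  {ω | Conn ends (restrict (touches ends (↑W : Set V))ᶜ ω) a₂ v}

omit [Fintype E] [DecidableEq E] in
/-- `restrict` is monotone in the configuration. -/
lemma restrict_mono (F : Set E) [DecidablePred (· ∈ F)] {ω ω' : Config E} (h : ω ≤ ω') :
    restrict F ω ≤ restrict F ω' := by
  intro e
  simp only [restrict]
  by_cases he : e ∈ F
  · simp only [he, decide_true, Bool.and_true]
    exact h e
  · simp only [he, decide_false, Bool.and_false, le_refl]

omit [Fintype E] [DecidableEq E] in
/-- `Rv` is an up-set. -/
lemma isUpperSet_Rv (ends : E → Sym2 V) (a₂ v : V) (W : Finset V) : IsUpperSet (Rv ends a₂ v W) := by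
  classical
  intro ω ω' h hω
  exact conn_mono (restrict_mono _ h) hω

omit [Fintype E] [DecidableEq E] in
/-- On `{C(a₃) = W}` with `a₂ ∉ W`, `{a₂ ↔ v} = Rv` pointwise. -/
lemma conn_right_iff_Rv {ends : E → Sym2 V} {a₂ a₃ v : V} {W : Finset V} (h₂ : a₂ ∉ W)
    {ω : Config E} (hω : ω ∈ clusterEvent ends a₃ (↑W : Set V)) :
    Conn ends ω a₂ v ↔ ω ∈ Rv ends a₂ v W := by
  classical
  rw [mem_clusterEvent] at hω
  have h₂' : a₂ ∉ (↑W : Set V) := fun h => h₂ (Finset.mem_coe.1 h)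
  exact (conn_restrict_iff_of_cluster_eq hω h₂').symm

variable {R : Type*} [Field R] [LinearOrder R] [IsStrictOrderedRing R]

omit [LinearOrder R] [IsStrictOrderedRing R] in
/-- Spatial Markov factorisation for an event of the deleted graph. -/
lemma prob_clusterEvent_inter_restrict (p : E → R) (ends : E → Sym2 V) (a₃ : V) (W : Finset V)
    (P : Config E → Prop) :
    prob p (clusterEvent ends a₃ (↑W : Set V) ∩
        {ω | P (restrict (touches ends (↑W : Set V))ᶜ ω)}) =
      prob p (clusterEvent ends a₃ (↑W : Set V)) *
        prob p {ω | P (restrict (touches ends (↑W : Set V))ᶜ ω)} := by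
  classical
  exact prob_clusterEvent_inter_eq_mul p ends a₃ _ (dependsOn_restrict _ P) disjoint_compl_right

omit [Fintype V] [LinearOrder R] [IsStrictOrderedRing R] in
/-- `P(C(a₃) = W, a₁ ↔ v) = P(C(a₃) = W)` if `v ∈ W`, `0` otherwise (`a₁ ∈ W`). -/
lemma prob_cl_conn_left (p : E → R) (ends : E → Sym2 V) (a₁ a₃ v : V) {W : Finset V}
    (h₁ : a₁ ∈ W) :
    prob p (clusterEvent ends a₃ (↑W : Set V) ∩ connEvent ends a₁ v) =
      if v ∈ W then prob p (clusterEvent ends a₃ (↑W : Set V)) else 0 := by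
  split_ifs with hv
  · congr 1
    ext ω
    simp only [Set.mem_inter_iff, mem_connEvent, and_iff_left_iff_imp]
    intro hω
    exact (conn_left_iff_of_mem_cluster h₁ hω).2 hv
  · rw [← prob_empty p]
    congr 1
    ext ω
    simp only [Set.mem_inter_iff, mem_connEvent, Set.mem_empty_iff_false, iff_false, not_and]
    intro hω h
    exact hv ((conn_left_iff_of_mem_cluster h₁ hω).1 h)

omit [LinearOrder R] [IsStrictOrderedRing R] in
/-- `P(C(a₃) = W, a₂ ↔ v) = 0` if `v ∈ W`, `= P(C(a₃) = W)·P(Rv)` otherwise (`a₂ ∉ W`). -/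
lemma prob_cl_conn_right (p : E → R) (ends : E → Sym2 V) (a₂ a₃ v : V) {W : Finset V}
    (h₂ : a₂ ∉ W) :
    prob p (clusterEvent ends a₃ (↑W : Set V) ∩ connEvent ends a₂ v) =
      if v ∈ W then 0
      else prob p (clusterEvent ends a₃ (↑W : Set V)) * prob p (Rv ends a₂ v W) := by
  classical
  split_ifs with hv
  · rw [← prob_empty p]
    congr 1
    ext ω
    simp only [Set.mem_inter_iff, mem_connEvent, Set.mem_empty_iff_false, iff_false, not_and]
    intro hω h
    exact not_conn_right_of_mem_cluster h₂ hv hω h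
  · have : clusterEvent ends a₃ (↑W : Set V) ∩ connEvent ends a₂ v =
        clusterEvent ends a₃ (↑W : Set V) ∩ Rv ends a₂ v W := by
      ext ω
      simp only [Set.mem_inter_iff, mem_connEvent]
      constructor
      · rintro ⟨hω, h⟩; exact ⟨hω, (conn_right_iff_Rv h₂ hω).1 h⟩
      · rintro ⟨hω, h⟩; exact ⟨hω, (conn_right_iff_Rv h₂ hω).2 h⟩
    rw [this]
    exact prob_clusterEvent_inter_restrict p ends a₃ W (fun ω' => Conn ends ω' a₂ v)

omit [Fintype V] [LinearOrder R] [IsStrictOrderedRing R] in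
/-- The four pair events on a T′ fibre. -/
lemma prob_cl_conn_left_left (p : E → R) (ends : E → Sym2 V) (a₁ a₃ b o : V) {W : Finset V}
    (h₁ : a₁ ∈ W) :
    prob p (clusterEvent ends a₃ (↑W : Set V) ∩ (connEvent ends a₁ b ∩ connEvent ends a₁ o)) =
      if b ∈ W ∧ o ∈ W then prob p (clusterEvent ends a₃ (↑W : Set V)) else 0 := by
  split_ifs with h
  · congr 1
    ext ω
    simp only [Set.mem_inter_iff, mem_connEvent, and_iff_left_iff_imp]
    intro hω
    exact ⟨(conn_left_iff_of_mem_cluster h₁ hω).2 h.1, (conn_left_iff_of_mem_cluster h₁ hω).2 h.2⟩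
  · rw [← prob_empty p]
    congr 1
    ext ω
    simp only [Set.mem_inter_iff, mem_connEvent, Set.mem_empty_iff_false, iff_false, not_and]
    intro hω hb ho
    exact h ⟨(conn_left_iff_of_mem_cluster h₁ hω).1 hb, (conn_left_iff_of_mem_cluster h₁ hω).1 ho⟩

omit [LinearOrder R] [IsStrictOrderedRing R] in
/-- `P(C(a₃) = W, a₁ ↔ b, a₂ ↔ o)` on a T′ fibre. -/
lemma prob_cl_conn_left_right (p : E → R) (ends : E → Sym2 V) (a₁ a₂ a₃ b o : V) {W : Finset V}
    (h₁ : a₁ ∈ W) (h₂ : a₂ ∉ W) :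
    prob p (clusterEvent ends a₃ (↑W : Set V) ∩ (connEvent ends a₁ b ∩ connEvent ends a₂ o)) =
      if b ∈ W ∧ o ∉ W then
        prob p (clusterEvent ends a₃ (↑W : Set V)) * prob p (Rv ends a₂ o W) else 0 := by
  classical
  split_ifs with h
  · have : clusterEvent ends a₃ (↑W : Set V) ∩ (connEvent ends a₁ b ∩ connEvent ends a₂ o) =
        clusterEvent ends a₃ (↑W : Set V) ∩ Rv ends a₂ o W := by
      ext ω
      simp only [Set.mem_inter_iff, mem_connEvent]
      constructor
      · rintro ⟨hω, _, ho⟩; exact ⟨hω, (conn_right_iff_Rv h₂ hω).1 ho⟩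
      · rintro ⟨hω, ho⟩
        exact ⟨hω, (conn_left_iff_of_mem_cluster h₁ hω).2 h.1, (conn_right_iff_Rv h₂ hω).2 ho⟩
    rw [this]
    exact prob_clusterEvent_inter_restrict p ends a₃ W (fun ω' => Conn ends ω' a₂ o)
  · rw [← prob_empty p]
    congr 1
    ext ω
    simp only [Set.mem_inter_iff, mem_connEvent, Set.mem_empty_iff_false, iff_false, not_and]
    intro hω hb ho
    apply h
    refine ⟨(conn_left_iff_of_mem_cluster h₁ hω).1 hb, fun hoW => ?_⟩
    exact not_conn_right_of_mem_cluster h₂ hoW hω ho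

omit [LinearOrder R] [IsStrictOrderedRing R] in
/-- `P(C(a₃) = W, a₂ ↔ b, a₁ ↔ o)` on a T′ fibre. -/
lemma prob_cl_conn_right_left (p : E → R) (ends : E → Sym2 V) (a₁ a₂ a₃ b o : V) {W : Finset V}
    (h₁ : a₁ ∈ W) (h₂ : a₂ ∉ W) :
    prob p (clusterEvent ends a₃ (↑W : Set V) ∩ (connEvent ends a₂ b ∩ connEvent ends a₁ o)) =
      if b ∉ W ∧ o ∈ W then
        prob p (clusterEvent ends a₃ (↑W : Set V)) * prob p (Rv ends a₂ b W) else 0 := by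
  classical
  split_ifs with h
  · have : clusterEvent ends a₃ (↑W : Set V) ∩ (connEvent ends a₂ b ∩ connEvent ends a₁ o) =
        clusterEvent ends a₃ (↑W : Set V) ∩ Rv ends a₂ b W := by
      ext ω
      simp only [Set.mem_inter_iff, mem_connEvent]
      constructor
      · rintro ⟨hω, hb, _⟩; exact ⟨hω, (conn_right_iff_Rv h₂ hω).1 hb⟩
      · rintro ⟨hω, hb⟩
        exact ⟨hω, (conn_right_iff_Rv h₂ hω).2 hb, (conn_left_iff_of_mem_cluster h₁ hω).2 h.2⟩
    rw [this]
    exact prob_clusterEvent_inter_restrict p ends a₃ W (fun ω' => Conn ends ω' a₂ b)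
  · rw [← prob_empty p]
    congr 1
    ext ω
    simp only [Set.mem_inter_iff, mem_connEvent, Set.mem_empty_iff_false, iff_false, not_and]
    intro hω hb ho
    apply h
    refine ⟨fun hbW => not_conn_right_of_mem_cluster h₂ hbW hω hb,
      (conn_left_iff_of_mem_cluster h₁ hω).1 ho⟩

omit [LinearOrder R] [IsStrictOrderedRing R] in
/-- `P(C(a₃) = W, a₂ ↔ b, a₂ ↔ o)` on a T′ fibre. -/
lemma prob_cl_conn_right_right (p : E → R) (ends : E → Sym2 V) (a₂ a₃ b o : V) {W : Finset V}
    (h₂ : a₂ ∉ W) :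
    prob p (clusterEvent ends a₃ (↑W : Set V) ∩ (connEvent ends a₂ b ∩ connEvent ends a₂ o)) =
      if b ∉ W ∧ o ∉ W then
        prob p (clusterEvent ends a₃ (↑W : Set V)) * prob p (Rv ends a₂ b W ∩ Rv ends a₂ o W)
      else 0 := by
  classical
  split_ifs with h
  · have : clusterEvent ends a₃ (↑W : Set V) ∩ (connEvent ends a₂ b ∩ connEvent ends a₂ o) =
        clusterEvent ends a₃ (↑W : Set V) ∩
          {ω | (fun ω' => Conn ends ω' a₂ b ∧ Conn ends ω' a₂ o)
            (restrict (touches ends (↑W : Set V))ᶜ ω)} := by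
      ext ω
      simp only [Set.mem_inter_iff, mem_connEvent, Set.mem_setOf_eq]
      constructor
      · rintro ⟨hω, hb, ho⟩
        exact ⟨hω, (conn_right_iff_Rv h₂ hω).1 hb, (conn_right_iff_Rv h₂ hω).1 ho⟩
      · rintro ⟨hω, hb, ho⟩
        exact ⟨hω, (conn_right_iff_Rv h₂ hω).2 hb, (conn_right_iff_Rv h₂ hω).2 ho⟩
    rw [this, prob_clusterEvent_inter_restrict p ends a₃ W
      (fun ω' => Conn ends ω' a₂ b ∧ Conn ends ω' a₂ o)]
    rfl
  · rw [← prob_empty p]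
    congr 1
    ext ω
    simp only [Set.mem_inter_iff, mem_connEvent, Set.mem_empty_iff_false, iff_false, not_and]
    intro hω hb ho
    apply h
    exact ⟨fun hbW => not_conn_right_of_mem_cluster h₂ hbW hω hb,
      fun hoW => not_conn_right_of_mem_cluster h₂ hoW hω ho⟩

/-- **The T′ fibres have nonnegative slack** (Harris on `G − W`). -/
theorem slack_nonneg_of_mem_left (p : E → R) (hp : IsProbVec p) (ends : E → Sym2 V)
    (o a₁ a₂ a₃ b : V) {W : Finset V} (h₁ : a₁ ∈ W) (h₂ : a₂ ∉ W) :
    0 ≤ slack p ends o a₁ a₂ a₃ b W := by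
  have hQ := fibre_eq_of_mem_left ends a₁ a₂ a₃ h₁ h₂
  have hs3 : s3 (R := R) a₁ a₂ W = 1 := by simp [s3, h₁]
  have hA : ¬ (a₁ ∉ W ∧ a₂ ∉ W) := fun h => h.1 h₁
  have hcl := prob_nonneg hp (clusterEvent ends a₃ (↑W : Set V))
  have hHarris := prob_mul_prob_le_prob_inter hp (isUpperSet_Rv ends a₂ b W)
    (isUpperSet_Rv ends a₂ o W)
  simp only [slack, Ssig, Su, SF, mW, hQ, hs3, if_neg hA, prob_cl_conn_left p ends a₁ a₃ _ h₁,
    prob_cl_conn_right p ends a₂ a₃ _ h₂, prob_cl_conn_left_left p ends a₁ a₃ b o h₁,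
    prob_cl_conn_left_right p ends a₁ a₂ a₃ b o h₁ h₂,
    prob_cl_conn_right_left p ends a₁ a₂ a₃ b o h₁ h₂,
    prob_cl_conn_right_right p ends a₂ a₃ b o h₂]
  by_cases hb : b ∈ W <;> by_cases ho : o ∈ W <;> simp only [hb, ho, and_self, and_true, and_false,
    not_true_eq_false, not_false_eq_true, if_true, if_false]
  · ring_nf; exact le_refl _
  · ring_nf; exact le_refl _
  · ring_nf; exact le_refl _
  · nlinarith [mul_nonneg hcl hcl, hHarris]

omit [Fintype V] [DecidableEq V] [Fintype E] [DecidableEq E] in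
/-- On a fibre with `a₂ ∈ W ∌ a₁` the event `Q = {a₁ ↮ a₂}` is automatic. -/
lemma fibre_eq_of_mem_right (ends : E → Sym2 V) (a₁ a₂ a₃ : V) {W : Finset V} (h₁ : a₁ ∉ W)
    (h₂ : a₂ ∈ W) : fibre ends a₁ a₂ a₃ W = clusterEvent ends a₃ (↑W : Set V) := by
  ext ω
  simp only [fibre, Set.mem_inter_iff, mem_clusterEvent]
  constructor
  · exact fun h => h.2
  · intro h
    refine ⟨?_, h⟩
    rw [mem_avoidAll]
    simp only [Finset.mem_singleton, forall_eq]
    intro hc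
    apply h₁
    have ha₂ : Conn ends ω a₃ a₂ := by
      have : a₂ ∈ cluster ends ω a₃ := by rw [h]; exact Finset.mem_coe.2 h₂
      exact this
    have : a₁ ∈ cluster ends ω a₃ := conn_trans ha₂ hc
    rw [h] at this
    exact Finset.mem_coe.1 this

/-- **The T fibres have nonnegative slack** (the mirror of `slack_nonneg_of_mem_left`: Harris on
`G − W` for the connections of `a₁`). -/
theorem slack_nonneg_of_mem_right (p : E → R) (hp : IsProbVec p) (ends : E → Sym2 V)
    (o a₁ a₂ a₃ b : V) {W : Finset V} (h₁ : a₁ ∉ W) (h₂ : a₂ ∈ W) :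
    0 ≤ slack p ends o a₁ a₂ a₃ b W := by
  have hQ := fibre_eq_of_mem_right ends a₁ a₂ a₃ h₁ h₂
  have hs3 : s3 (R := R) a₁ a₂ W = -1 := by simp [s3, h₁, h₂]
  have hA : ¬ (a₁ ∉ W ∧ a₂ ∉ W) := fun h => h.2 h₂
  have hcl := prob_nonneg hp (clusterEvent ends a₃ (↑W : Set V))
  have hHarris := prob_mul_prob_le_prob_inter hp (isUpperSet_Rv ends a₁ b W)
    (isUpperSet_Rv ends a₁ o W)
  simp only [slack, Ssig, Su, SF, mW, hQ, hs3, if_neg hA, prob_cl_conn_left p ends a₂ a₃ _ h₂,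
    prob_cl_conn_right p ends a₁ a₃ _ h₁, prob_cl_conn_left_left p ends a₂ a₃ b o h₂,
    prob_cl_conn_left_right p ends a₂ a₁ a₃ b o h₂ h₁,
    prob_cl_conn_right_left p ends a₂ a₁ a₃ b o h₂ h₁,
    prob_cl_conn_right_right p ends a₁ a₃ b o h₁]
  by_cases hb : b ∈ W <;> by_cases ho : o ∈ W <;> simp only [hb, ho, and_self, and_true, and_false,
    not_true_eq_false, not_false_eq_true, if_true, if_false]
  · ring_nf; exact le_refl _
  · ring_nf; exact le_refl _
  · ring_nf; exact le_refl _
  · nlinarith [mul_nonneg hcl hcl, hHarris]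

end Left

end A3Fibre

end CovForm

end Summit.Ventures.PercRepro2
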